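import Literature.Algebra.EuclideanLattices.RegevQuantumPartLawNear
import Literature.Computability.QuantumComplexity.TidyBlockFnStage
import HarnessLib

/-!
# Regev 2009, Lemma 3.14 with a bounded-error subroutine in the two oracle slots: the measured law

Topic `Literature/Algebra/EuclideanLattices`, grouping namespace `Regev2009.QPart`; sequel of
`RegevQuantumPartLawNear.lean` (`law_bound_of_basis_near`: the law after a unitary classical stage `M_re`
that is `ε_S`-close to the ideal basis map `M_cl` on the box Gaussian) and of
`QuantumComplexity/TidyBlockFnStage.lean` (for the five-factor stage `G·C_X·G·C_S·C_Y` with `G = ` the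
placed tidy block around a subroutine `Sub` versus `G = ` the placed ideal gate `U_f`, on a superposition
of basis labels whose ideal run is clean at the two calls, `ε_S ≤ 4√(Σ_x errFn(q(x)) |a(x)|²)`). This is the oracle
substitution in Regev's sampler (J. ACM 56 (2009), art. 34, Lemma 3.14 run, as in the proof of Lemma 3.3,
with the `CVP` procedure of Lemma 3.4 — a bounded-error quantum subroutine computing a MANY-BIT answer —
in place of the `CVP` oracle: two calls, "this allows us to uncompute the first register"), carried out
once and for all at the level of the register:

* (register level, `QuantumComplexity/TidyBlockFnStage.lean`: `TidyBlockFn.StageHyps` — the three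
  classical blocks are unitary basis maps along `κ_Y, κ_S, κ_X`, the labels of the IDEAL run at the two
  calls are clean on the placed subroutine wires, the erasing block does not touch the query wires;
  `TidyBlockFn.kappaSt` — the label action `κ_O ∘ κ_X ∘ κ_O ∘ κ_S ∘ κ_Y` of the ideal stage;
  `TidyBlockFn.l2Norm_stage_sum_sub_le` — `‖stage(T_E) Φ − stage((U_f)_E) Φ‖₂ ≤ 4 √(Σ_x errFn(q(x)) |a(x)|²)`);
* **`QPart.law_bound_of_basis_subst`** — Regev's Lemma 3.14 measured-law bound for the machine whose
  classical stage runs the tidy blocks of `Sub`: the bound of `law_bound_of_basis` with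
  `ε₁ + 4√(Σ_{x ∈ Box} (ρ(x)/Z)² · errFn_f(Sub)(q(x)))` in place of `ε₁` — for EVERY error profile of
  `Sub` at once (the average is later identified with the weighted failure of the `CVP` family,
  `Cryptography/RegevCVPOracleWeighted.lean`).

Everything is proved; definitions have bodies; no named fact is introduced.

## References

* O. Regev, *On lattices, learning with errors, random linear codes, and cryptography*, J. ACM 56
  (2009), art. 34; author's version arXiv:2401.03703: Lemma 3.14 (proof), Lemma 3.3 (proof)
  [Regev2009].
* C. H. Bennett, E. Bernstein, G. Brassard, U. Vazirani, *Strengths and weaknesses of quantum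
  computing*, SIAM J. Comput. 26 (1997) 1510–1523, Thm. 3.1, Thm. 3.3 (hybrid argument), Thm. 4.14
  (tidy subroutines) [BennettBernsteinBrassardVazirani1997].
* M. A. Nielsen, I. L. Chuang, *Quantum Computation and Quantum Information*, CUP 2010, §3.2.5
  (uncomputation), §4.3, §6.1.1 [NielsenChuang2010].
-/

noncomputable section

open Module Metric Finset _root_.Matrix
open scoped Real InnerProductSpace ENNReal Kronecker

namespace Literature.Algebra.EuclideanLattices

namespace Regev2009

namespace QPart

open Literature.Computability.Cryptography Literature.Computability.QuantumComplexity
  Literature.Computability.QuantumComplexity.QState Literature.Computability.QuantumComplexity.QFTQubits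
  Literature.Computability.QuantumComplexity.TidyBlockFn

/-! ### The measured law -/

variable {V : Type*} {W m κ : ℕ}
variable {S : Fin m → (Fin κ ↪ Fin W)} {base : V → QReg W} {enc : ZMod (2 ^ κ) → Fin κ → Bool}
  {Box : Finset V} {yOf : V → V} {sOf : V → Fin m → ZMod (2 ^ κ)} {Good : V → Prop}
  {lab₀ : V → QReg W}
variable [NormedAddCommGroup V] [InnerProductSpace ℝ V] [DecidableEq V]

omit [InnerProductSpace ℝ V] [DecidableEq V] in
/-- The Gaussian weights of the box: `|ρ(x)/Z|² = (ρ(x)/Z)²` as the squared norm of the complex amplitude.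
[folklore] -/
theorem norm_amp_sq (Box : Finset V) (x : V) :
    ‖(((gaussianFunction 1 x / zBox Box : ℝ)) : ℂ)‖ ^ 2 = (gaussianFunction 1 x / zBox Box) ^ 2 := by
  rw [Complex.norm_real, Real.norm_eq_abs, sq_abs]

open Classical in
/-- **Regev 2009, Lemma 3.14 with a bounded-error subroutine in the oracle slots (machine form).** As
`law_bound_of_basis`, for the machine `M_F · (T_E·C_X·T_E·C_S·C_Y) · (Gaussian stage)` whose classical stage
runs the placed tidy blocks `T_E` of a subroutine `Sub` for the function `f` (register hypotheses
`StageHyps`, final labels `kappaSt`): for every event `A`,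

  `|Pr[dec (readS z) ∈ A] − D_{L,1/√2}(A)| ≤ 2(ε₁ + 4√(Σ_{x ∈ Box} errFn_f(Sub)(q(x)) (ρ(x)/Z)²) + ε_F + 8C) + 2η₀ + 9·2⁻ⁿ`

— the subroutine is charged only through the Gaussian average of its error over the queries `q(x)`
actually asked. [cite: Regev2009, Lemma 3.14 (proof), Lemma 3.3 (proof)] [cite: BennettBernsteinBrassardVazirani1997, Thm. 3.3, Thm. 4.14] -/
theorem law_bound_of_basis_subst [FiniteDimensional ℝ V] [MeasurableSpace V] [BorelSpace V] [Nontrivial V]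
    {k ℓ d : ℕ} {E : Fin (TidyBlockFn.W k ℓ d) ↪ Fin W} {fn : QReg k → QReg ℓ}
    {CX CS CY : Matrix (QReg W) (QReg W) ℂ} {κX κS κY : QReg W → QReg W}
    (hSt : StageHyps E fn CX CS CY κX κS κY Box lab₀) (Sub : QCircuit cliffordT (k + d))
    (L : Submodule ℤ V) [DiscreteTopology L] [IsZLattice ℝ L] (bL : Basis (Fin m) ℤ L) [NeZero (2 ^ κ : ℕ)] [DecidablePred Good]
    (hH : FibreHyps (dualOver (2 ^ κ) L bL) (dualOverZBasis (2 ^ κ) L bL) (2 ^ κ) Box yOf sOf Good)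
    (hR : RegHyps S base enc Box yOf sOf Good lab₀ (kappaSt E fn κX κS κY)) (hne : Box.Nonempty)
    -- lattice hypotheses
    (hsvΛ : ∀ z ∈ scaledLattice (dualOver (2 ^ κ) L bL) (2 ^ κ), ‖z‖ < 2 * Real.sqrt (finrank ℝ V) → z = 0)
    (hL : ∀ x ∈ L, ‖((2 ^ κ : ℕ) : ℝ) • x‖ < 2 * Real.sqrt (finrank ℝ V) → x = 0)
    {dec : (Fin m → ZMod (2 ^ κ)) → V}
    (hdec : ∀ t : Fin m → ZMod (2 ^ κ), ∀ x ∈ L,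
      ‖∑ j, ((t j).val : ℝ) • ((bL j : L) : V) + ((2 ^ κ : ℕ) : ℝ) • x‖ < Real.sqrt (finrank ℝ V) →
        dec t = ∑ j, ((t j).val : ℝ) • ((bL j : L) : V) + ((2 ^ κ : ℕ) : ℝ) • x)
    {B Y C : ℝ} (hBox : ∀ x ∈ Box, BoxCoversShort (dualOver (2 ^ κ) L bL) Box (yOf x)) (hY : ∀ x ∈ Box, ‖yOf x‖ ≤ Y)
    (hB : ∀ x ∈ Box, ∀ x' ∈ Box, ‖x - yOf x'‖ ≤ B) (hδ : π * (2 * Real.sqrt (finrank ℝ V) * Y + Y ^ 2) < 1)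
    (hC : Real.exp (2 * π * B * Y) * (2⁻¹ : ℝ) ^ finrank ℝ V ≤
      C * ((1 - π * (2 * Real.sqrt (finrank ℝ V) * Y + Y ^ 2)) * (1 - banaConst ^ finrank ℝ V) * (1 - (4⁻¹ : ℝ) ^ finrank ℝ V)))
    (hC2 : C ≤ 1 / 2) (hC0 : 0 ≤ C)
    -- machine hypotheses
    {ΨGR : QReg W → ℂ} (hΨGR : l2Norm ΨGR = 1) {ε₁ : ℝ}
    (hε₁ : l2Norm (ΨGR - embed Box (fun x => (((gaussianFunction 1 x / zBox Box : ℝ)) : ℂ)) lab₀) ≤ ε₁)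
    {MF : Matrix (QReg W) (QReg W) ℂ} (hMFU : MF ∈ Matrix.unitaryGroup (QReg W) ℂ) {PF : Set (QReg W)} {εF : ℝ}
    (hMF : ImplOn PF MF (multiQFT S) εF) (hPF : ∀ x ∈ Box, kappaSt E fn κX κS κY (lab₀ x) ∈ PF)
    (A : Set V) :
    |∑ z ∈ univ.filter (fun z => dec (readS S z) ∈ A),
        ‖(MF *ᵥ (stage CX CS CY (placeGate E (tidyCirc Sub).mat) *ᵥ ΨGR)) z‖ ^ 2 -
        ((discreteGaussian L (Real.sqrt 2)⁻¹ 0).toOuterMeasure {x : L | (x : V) ∈ A}).toReal| ≤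
      2 * (ε₁ + 4 * Real.sqrt (∑ x ∈ Box, errFn fn Sub (queryOf E (κS (κY (lab₀ x)))) *
              (gaussianFunction 1 x / zBox Box) ^ 2) + εF + 8 * C) +
        2 * (Real.sqrt (2 * (π * (2 * Real.sqrt (finrank ℝ V) * Y + Y ^ 2) + banaConst ^ finrank ℝ V + 4⁻¹ ^ finrank ℝ V)) +
          2 * (2⁻¹ : ℝ) ^ finrank ℝ V) + 9 * (2⁻¹ : ℝ) ^ finrank ℝ V := by
  have hεS := l2Norm_stage_sum_sub_le hSt hR.lab_inj (fun x => (((gaussianFunction 1 x / zBox Box : ℝ)) : ℂ)) Sub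
  simp_rw [norm_amp_sq] at hεS
  rw [show (∑ x ∈ Box, (((gaussianFunction 1 x / zBox Box : ℝ)) : ℂ) • basisState (lab₀ x)) =
    embed Box (fun x => (((gaussianFunction 1 x / zBox Box : ℝ)) : ℂ)) lab₀ from rfl] at hεS
  exact law_bound_of_basis_near L bL hH hR hne hsvΛ hL hdec hBox hY hB hδ hC hC2 hC0 hΨGR hε₁
    (isBasisMap_stage_idealFn hSt) (stage_idealFn_mem_unitaryGroup hSt) (stage_tidyCirc_mem_unitaryGroup hSt Sub)
    hεS hMFU hMF hPF A

end QPart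

end Regev2009

end Literature.Algebra.EuclideanLattices

end
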